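import Mathlib.AlgebraicGeometry.Morphisms.Smooth
import Mathlib.RingTheory.WittVector.Complete
import Mathlib.RingTheory.Flat.Basic
import Mathlib.RingTheory.RingHom.Flat
import Summits.HodgeConjecture.HodgeConjecture.Theorems.PadicSemiregularLiftPadicPridhamSemiregularityThickeningMapFirstOrder
import Summits.HodgeConjecture.HodgeConjecture.Theorems.PadicSemiregularLiftPadicPridhamSemiregularitySpecialFibreClosedImmersion
import HarnessLib

/-!
# Functions on the `p`-adic tower `X_k ↪ X_{n+1} ↪ X_{n+2}` of a smooth `W(k)`-scheme, on affine opens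

For a prime `p`, a perfect field `k` of characteristic `p`, `W = W(k)`, `W_m = W/p^m`, a `W`-scheme
`𝒳` with thickenings `X_m = 𝒳 ×_W Spec W_m` and special fibre `X_k = 𝒳 ×_W Spec k`
(`Literature.AlgebraicGeometry.Motives.WittScheme`), and an AFFINE open `U`, the section-level facts
behind the identification `p^{n+1}𝒪_{X_{n+2}} ≅ 𝒪_{X_k}` of stub G3 (`stub_conormalSheaf_thickeningMap`)
of line `sigma-ob-kzero-additivity` of the crux `PadicPridhamSemiregularity` (route `PadicSemiregularLift`
of `HodgeConjecture`):

* (F1) `ker (Γ(X_n, U) → Γ(X_m, U ∩ X_m)) ⊆ (p^m)` and (F2) `ker (Γ(X_{n+1}, U) → Γ(X_k, U ∩ X_k)) ⊆ (p)`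
  (`ker_app_thickeningMap_le`, `ker_app_specialFibreToThickening_le`) — instances of
  `ker_app_le_span_of_isPullback`: for a base change `i` of `Spec (R ↠ R')` with `ker ⊆ (q)`, `q ∈ ℕ`,
  `ker (i♯ on Γ(Y, U)) ⊆ (q)` for affine `U` (computed on `Spec Γ(Y, U)`, where `i` is
  `Spec (A ⊗_R R') → Spec A`, Mathlib `pullbackSpecIso`, `Scheme.Hom.ker_apply`,
  `Scheme.ker_ideal_of_isPullback_of_isOpenImmersion`; the kernels `ker (W_n → W_m) = (p^m)` and
  `ker (W_{n+1} → k) = (p)`, the latter by Mathlib `WittVector.ker_constantCoeff` for `k` perfect);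
* (F3) `p^m = 0` on `X_m`, `p = 0` on `X_k`;
* (F4) for `𝒳/W` smooth (flat): `p^{n+1} b = 0 ⟹ b ∈ (p)` in `Γ(X_{n+2}, U)` — flat base change
  (Mathlib `Module.Flat.lTensor_exact`, `HasRingHomProperty @Flat`) of the exact sequence
  `W_{n+2} →p→ W_{n+2} →p^{n+1}→ W_{n+2}` (`W(k)` has no `p`-torsion, Mathlib
  `WittVector.eq_zero_of_p_mul_eq_zero`). This is where smoothness of `𝒳` is load-bearing.

Everything is proved; no definitions.
-/

noncomputable section

-- the mandated namespace `Summit.HodgeConjecture.HodgeConjecture.…` repeats a component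
set_option linter.dupNamespace false

open CategoryTheory CategoryTheory.Limits AlgebraicGeometry TensorProduct
  Literature.AlgebraicGeometry.Motives Literature.AlgebraicGeometry.Motives.WittScheme

universe u

namespace Summit.HodgeConjecture.HodgeConjecture.Theorems.PadicPridhamSemiregularity

/-! ### Ring-level facts -/

/-- **Flat base change of a torsion relation.** Let `f : R → A` be flat and `x, y ∈ R` with
`x·y = 0` and `ann_R(x) ⊆ (y)` (so that `R →y→ R →x→ R` is exact). Then `ann_A(f x) ⊆ (f y)`
(Mathlib `Module.Flat.lTensor_exact`). [folklore] -/
theorem mem_span_of_mul_eq_zero_of_flat {R A : Type*} [CommRing R] [CommRing A] {f : R →+* A}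
    (hf : f.Flat) {x y : R} (hxy : x * y = 0) (hann : ∀ r : R, x * r = 0 → r ∈ Ideal.span {y})
    {a : A} (ha : f x * a = 0) : a ∈ Ideal.span {f y} := by
  letI := f.toAlgebra
  haveI : Module.Flat R A := hf
  have hex : Function.Exact (y • LinearMap.id : R →ₗ[R] R) (x • LinearMap.id : R →ₗ[R] R) := by
    intro r
    simp only [LinearMap.smul_apply, LinearMap.id_coe, id_eq, smul_eq_mul, Set.mem_range]
    constructor
    · intro hr
      obtain ⟨c, hc⟩ := Ideal.mem_span_singleton'.mp (hann r hr)
      exact ⟨c, by rw [mul_comm] at hc; exact hc⟩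
    · rintro ⟨c, rfl⟩
      rw [← mul_assoc, hxy, zero_mul]
  have hexA := Module.Flat.lTensor_exact A hex
  rw [LinearMap.lTensor_smul, LinearMap.lTensor_smul] at hexA
  simp only [LinearMap.lTensor_id] at hexA
  have h1 : (x • (LinearMap.id : A ⊗[R] R →ₗ[R] A ⊗[R] R)) (a ⊗ₜ 1) = 0 := by
    rw [LinearMap.smul_apply, LinearMap.id_apply, TensorProduct.smul_tmul', Algebra.smul_def,
      RingHom.algebraMap_toAlgebra, ha, TensorProduct.zero_tmul]
  obtain ⟨t, ht⟩ := (hexA _).mp h1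
  have h2 := congrArg (TensorProduct.rid R A) ht
  rw [LinearMap.smul_apply, LinearMap.id_apply, map_smul, TensorProduct.rid_tmul, one_smul,
    Algebra.smul_def, RingHom.algebraMap_toAlgebra] at h2
  exact Ideal.mem_span_singleton'.mpr ⟨TensorProduct.rid R A t, by rw [mul_comm]; exact h2⟩

/-- Membership in the principal ideal `(q)`, `q ∈ ℕ`, is preserved by ring maps. [folklore] -/
theorem mem_span_natCast_of_map {A B : Type*} [CommRing A] [CommRing B] (g : A →+* B) (q : ℕ)
    {x : A} (hx : x ∈ Ideal.span {(q : A)}) : g x ∈ Ideal.span {(q : B)} := by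
  obtain ⟨c, rfl⟩ := Ideal.mem_span_singleton'.mp hx
  rw [map_mul, map_natCast]
  exact Ideal.mem_span_singleton'.mpr ⟨g c, rfl⟩

/-- Transfer of `I ≤ (q)` along a ring map `g` with left inverse `g'` into an ideal `J ≤ (q)`.
[folklore] -/
theorem le_span_natCast_of_leftInverse {A B : Type*} [CommRing A] [CommRing B]
    (g : A →+* B) (g' : B →+* A) (hg : ∀ x, g' (g x) = x) (q : ℕ) {I : Ideal A} {J : Ideal B}
    (hJ : J ≤ Ideal.span {(q : B)}) (h : ∀ x ∈ I, g x ∈ J) : I ≤ Ideal.span {(q : A)} := by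
  intro x hx
  rw [← hg x]
  exact mem_span_natCast_of_map g' q (hJ (h x hx))

section Witt

variable {p : ℕ} [Fact p.Prime] {k : Type u} [CommRing k]

/-- `ker (W_n → W_m) ⊆ (p^m)`. [folklore] -/
theorem ker_factor_le_span {m n : ℕ} (h : m ≤ n) :
    RingHom.ker (Ideal.Quotient.factor
      (Ideal.pow_le_pow_right h : Ideal.span {(p : WittVector p k)} ^ n ≤ _)) ≤
      Ideal.span {((p ^ m : ℕ) : wittQuot p k n)} := by
  intro x hx
  obtain ⟨a, rfl⟩ := Ideal.Quotient.mk_surjective x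
  rw [RingHom.mem_ker, Ideal.Quotient.factor_mk, Ideal.Quotient.eq_zero_iff_mem,
    Ideal.span_singleton_pow, Ideal.mem_span_singleton'] at hx
  obtain ⟨c, rfl⟩ := hx
  rw [map_mul, map_pow, map_natCast, Nat.cast_pow]
  exact Ideal.mul_mem_left _ _ (Ideal.subset_span rfl)

/-- `ker (W_{n+1} → k) ⊆ (p)` for `k` perfect (Mathlib `WittVector.ker_constantCoeff`). [folklore] -/
theorem ker_wittQuotToResidue_le_span [CharP k p] [PerfectRing k p] (n : ℕ) :
    RingHom.ker (wittQuotToResidue p k n) ≤ Ideal.span {((p ^ 1 : ℕ) : wittQuot p k (n + 1))} := by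
  intro x hx
  obtain ⟨a, rfl⟩ := Ideal.Quotient.mk_surjective x
  have ha : a ∈ RingHom.ker (WittVector.constantCoeff : WittVector p k →+* k) := hx
  rw [WittVector.ker_constantCoeff, Ideal.mem_span_singleton'] at ha
  obtain ⟨c, rfl⟩ := ha
  rw [map_mul, map_natCast, pow_one]
  exact Ideal.mul_mem_left _ _ (Ideal.subset_span rfl)

/-- `W(k)` has no `p`-power torsion for `k` perfect (Mathlib `WittVector.eq_zero_of_p_mul_eq_zero`).
[folklore] -/
theorem eq_zero_of_mul_p_pow_eq_zero [CharP k p] [PerfectRing k p] (m : ℕ) (x : WittVector p k)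
    (hx : x * ((p ^ m : ℕ) : WittVector p k) = 0) : x = 0 := by
  induction m generalizing x with
  | zero => simpa using hx
  | succ m ih =>
    rw [pow_succ, Nat.cast_mul, ← mul_assoc] at hx
    exact ih x (WittVector.eq_zero_of_p_mul_eq_zero _ hx)

/-- In `W_{n+2}`: `p^{n+1} r = 0 ⟹ r ∈ (p)` (`W(k)` has no `p`-torsion for `k` perfect). [folklore] -/
theorem mem_span_p_of_pow_mul_eq_zero [CharP k p] [PerfectRing k p] (n : ℕ)
    (r : wittQuot p k (n + 2)) (hr : ((p ^ (n + 1) : ℕ) : wittQuot p k (n + 2)) * r = 0) :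
    r ∈ Ideal.span {((p ^ 1 : ℕ) : wittQuot p k (n + 2))} := by
  obtain ⟨s, rfl⟩ := Ideal.Quotient.mk_surjective r
  rw [← map_natCast (Ideal.Quotient.mk (Ideal.span {(p : WittVector p k)} ^ (n + 2))),
    ← map_mul, Ideal.Quotient.eq_zero_iff_mem, Ideal.span_singleton_pow, ← Nat.cast_pow,
    Ideal.mem_span_singleton'] at hr
  obtain ⟨t, ht⟩ := hr
  have e : ((p ^ (n + 2) : ℕ) : WittVector p k) = (p : WittVector p k) * ((p ^ (n + 1) : ℕ) :) := by
    rw [← Nat.cast_mul, ← pow_succ']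
  have h0 : (s - p * t) * ((p ^ (n + 1) : ℕ) : WittVector p k) = 0 := by
    rw [sub_mul, mul_comm s, ← ht, e]; ring
  rw [sub_eq_zero.mp (eq_zero_of_mul_p_pow_eq_zero _ _ h0), map_mul, map_natCast, pow_one]
  exact Ideal.mul_mem_right _ _ (Ideal.subset_span rfl)

/-- `p^n = 0` in `W_n`. [folklore] -/
theorem natCast_pow_eq_zero_wittQuot (n : ℕ) : ((p ^ n : ℕ) : wittQuot p k n) = 0 := by
  rw [← map_natCast (Ideal.Quotient.mk (Ideal.span {(p : WittVector p k)} ^ n)),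
    Ideal.Quotient.eq_zero_iff_mem, Ideal.span_singleton_pow, ← Nat.cast_pow]
  exact Ideal.subset_span rfl

end Witt

/-! ### Kernels of base changes of `Spec` of a surjection, on affine opens -/

/-- Affine model: for `R → R'` surjective with `ker ⊆ (q)` and any `R → A`, the kernel ideal sheaf
of `Spec A ×_{Spec R} Spec R' ⟶ Spec A` on `⊤` is `⊆ (q)` (it is `Spec (A ⊗_R R') ⟶ Spec A`,
Mathlib `pullbackSpecIso`, with ring kernel `ker(R → R')·A`). [folklore] -/
theorem ker_pullbackFst_ideal_top_le {R A R' : Type u} [CommRing R] [CommRing A]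
    [CommRing R'] (φ : R →+* R') (ψ : R →+* A) (hφ : Function.Surjective φ) (q : ℕ)
    (hK : RingHom.ker φ ≤ Ideal.span {(q : R)}) :
    (pullback.fst (Spec.map (CommRingCat.ofHom ψ)) (Spec.map (CommRingCat.ofHom φ))).ker.ideal
      ⟨⊤, isAffineOpen_top _⟩ ≤ Ideal.span {(q : Γ(Spec (.of A), ⊤))} := by
  letI := φ.toAlgebra
  letI := ψ.toAlgebra
  change (pullback.fst (Spec.map (CommRingCat.ofHom (algebraMap R A)))
      (Spec.map (CommRingCat.ofHom (algebraMap R R')))).ker.ideal ⟨⊤, isAffineOpen_top _⟩ ≤ _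
  rw [← pullbackSpecIso_hom_fst', Scheme.Hom.ker_comp_of_isIso, Scheme.ker_of_isAffine]
  set f := Spec.map (CommRingCat.ofHom (algebraMap A (A ⊗[R] R'))) with hf
  have hJ : RingHom.ker (algebraMap A (A ⊗[R] R')) ≤ Ideal.span {(q : A)} := by
    rw [ker_algebraMap_tensorProduct_of_surjective (A := A) hφ]
    refine (Ideal.map_mono hK).trans ?_
    rw [Ideal.map_span, Set.image_singleton, map_natCast]
  have hK' : RingHom.ker f.appTop.hom ≤ Ideal.span {(q : Γ(Spec (.of A), ⊤))} := by
    refine le_span_natCast_of_leftInverse (Scheme.ΓSpecIso (.of A)).hom.hom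
      (Scheme.ΓSpecIso (.of A)).inv.hom (fun x => ?_) q hJ fun x hx => ?_
    · exact congrArg (fun e => e.hom x) (Scheme.ΓSpecIso (.of A)).hom_inv_id
    have nat := congrArg (fun g => g.hom x)
      (Scheme.ΓSpecIso_naturality (CommRingCat.ofHom (algebraMap A (A ⊗[R] R'))))
    simp only [CommRingCat.hom_comp, RingHom.comp_apply, CommRingCat.hom_ofHom] at nat
    rw [RingHom.mem_ker] at hx ⊢
    rw [← nat, ← hf, hx, map_zero]
  simp only [Scheme.IdealSheafData.ofIdealTop_ideal]
  refine (Ideal.map_mono hK').trans ?_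
  rw [Ideal.map_span, Set.image_singleton, map_natCast]

/-- Transfer along an open immersion `g : X' ⟶ Y`: if the base change `X' ×_Y Z ⟶ X'` of a
quasi-compact `i : Z ⟶ Y` has kernel ideal `⊆ (q)` on an affine open `W ⊆ X'`, then so does `i` on
`g(W)` (Mathlib `Scheme.ker_ideal_of_isPullback_of_isOpenImmersion`). [folklore] -/
theorem ker_ideal_le_span_of_isOpenImmersion {X' Y Z : Scheme.{u}} (i : Z ⟶ Y)
    [QuasiCompact i] (g : X' ⟶ Y) [IsOpenImmersion g] (W : X'.affineOpens) (q : ℕ)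
    (h : (pullback.snd i g).ker.ideal W ≤ Ideal.span {(q : Γ(X', W))}) :
    i.ker.ideal ⟨g ''ᵁ W, W.2.image_of_isOpenImmersion g⟩ ≤
      Ideal.span {(q : Γ(Y, g ''ᵁ W))} := by
  have hker := Scheme.ker_ideal_of_isPullback_of_isOpenImmersion i (pullback.snd i g)
    (pullback.fst i g) g (IsPullback.of_hasPullback i g).flip W
  have hinv : ∀ x, (g.appIso W).inv.hom ((g.appIso W).hom.hom x) = x :=
    fun x => congrArg (fun e => e.hom x) (g.appIso W).hom_inv_id
  refine le_span_natCast_of_leftInverse (g.appIso W).hom.hom (g.appIso W).inv.hom hinv q h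
    fun x hx => ?_
  rw [hker, Ideal.mem_comap]
  change (g.appIso W).inv.hom ((g.appIso W).hom.hom x) ∈ _
  rwa [hinv]

/-- **Kernels of base changes of `Spec` of a surjection.** Let `φ : R → R'` be a surjective ring
map with `ker φ ⊆ (q)` for a natural number `q`, and let `i : Z ⟶ Y` be a base change of
`Spec φ : Spec R' ⟶ Spec R` along some `Y ⟶ Spec R`. Then for every affine open `V ⊆ Y` the
kernel of `i♯ : Γ(Y, V) → Γ(Z, i⁻¹V)` is contained in `(q)`. (Checked on `Spec Γ(Y, V)`, where `i`
restricts to `Spec (A ⊗_R R') ⟶ Spec A`; Mathlib `Scheme.Hom.ker_apply`.) [folklore] -/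
theorem ker_app_le_span_of_isPullback {R R' : Type u} [CommRing R] [CommRing R']
    {φ : R →+* R'} (hφ : Function.Surjective φ) (q : ℕ) (hK : RingHom.ker φ ≤ Ideal.span {(q : R)})
    {Y Z : Scheme.{u}} {i : Z ⟶ Y} {q' : Z ⟶ Spec (.of R')} {f : Y ⟶ Spec (.of R)}
    (H : IsPullback i q' f (Spec.map (CommRingCat.ofHom φ))) {V : Y.Opens} (hV : IsAffineOpen V) :
    RingHom.ker (i.app V).hom ≤ Ideal.span {(q : Γ(Y, V))} := by
  haveI : IsClosedImmersion i :=
    MorphismProperty.of_isPullback H.flip (IsClosedImmersion.spec_of_surjective _ hφ)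
  rw [← Scheme.Hom.ker_apply i ⟨V, hV⟩]
  let g : Spec Γ(Y, V) ⟶ Y := hV.fromSpec
  have HV : IsPullback (pullback.snd i g) (pullback.fst i g) g i :=
    (IsPullback.of_hasPullback i g).flip
  let ψ : CommRingCat.of R ⟶ Γ(Y, V) :=
    (Scheme.ΓSpecIso (.of R)).inv ≫ f.appLE ⊤ V (fun _ _ => trivial)
  have hgq : g ≫ f = Spec.map ψ := by
    simp only [ψ, g, Spec.map_comp, ← Scheme.isoSpec_Spec_inv, ← IsAffineOpen.fromSpec_top]
    exact (IsAffineOpen.SpecMap_appLE_fromSpec f (isAffineOpen_top _) hV _).symm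
  have HV' : IsPullback (pullback.snd i g) (pullback.fst i g ≫ q')
      (Spec.map (CommRingCat.ofHom ψ.hom)) (Spec.map (CommRingCat.ofHom φ)) := by
    rw [CommRingCat.ofHom_hom, ← hgq]
    exact HV.paste_vert H
  have hD := ker_pullbackFst_ideal_top_le φ ψ.hom hφ q hK
  rw [← Scheme.Hom.ker_comp_of_isIso HV'.isoPullback.hom, HV'.isoPullback_hom_fst] at hD
  have h' := ker_ideal_le_span_of_isOpenImmersion i g ⟨⊤, isAffineOpen_top _⟩ q hD
  have heq : (⟨g ''ᵁ (⊤ : (Spec Γ(Y, V)).Opens),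
      (isAffineOpen_top _).image_of_isOpenImmersion g⟩ : Y.affineOpens) = ⟨V, hV⟩ :=
    Subtype.ext (by simp [g, Scheme.Hom.image_top_eq_opensRange])
  have hP : ∀ W : Y.affineOpens, i.ker.ideal W ≤ Ideal.span {(q : Γ(Y, (W : Y.Opens)))} →
      W = ⟨V, hV⟩ → i.ker.ideal ⟨V, hV⟩ ≤ Ideal.span {(q : Γ(Y, V))} := by
    rintro W hW rfl
    exact hW
  exact hP _ h' heq

/-! ### Sections of a scheme over `Spec R` -/

/-- A natural number vanishing in `R` vanishes in the sections of any `R`-scheme `S ⟶ Spec R`.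
[folklore] -/
theorem natCast_eq_zero_of_over {R : CommRingCat.{u}} {S : Scheme.{u}} (f : S ⟶ Spec R)
    (U : S.Opens) (c : ℕ) (hc : (c : R) = 0) : (c : Γ(S, U)) = 0 := by
  rw [← map_natCast ((f.appLE ⊤ U le_top).hom.comp (Scheme.ΓSpecIso R).inv.hom), hc, map_zero]

/-- For a flat `S ⟶ Spec R` and an affine open `U ⊆ S`, the structure map `R → Γ(S, U)` is flat
(Mathlib `HasRingHomProperty @Flat RingHom.Flat`). [folklore] -/
theorem flat_appLE_comp_ΓSpecIso_inv {R : CommRingCat.{u}} {S : Scheme.{u}} (f : S ⟶ Spec R)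
    [Flat f] {U : S.Opens} (hU : IsAffineOpen U) :
    ((f.appLE ⊤ U le_top).hom.comp (Scheme.ΓSpecIso R).inv.hom).Flat :=
  RingHom.Flat.comp
    (RingHom.Flat.of_bijective (Scheme.ΓSpecIso R).symm.commRingCatIsoToRingEquiv.bijective)
    (HasRingHomProperty.appLE @Flat f inferInstance ⟨⊤, isAffineOpen_top _⟩ ⟨U, hU⟩ le_top)

/-! ### The `p`-adic tower: pullback squares, closed immersions, (F1)–(F4) -/

section Tower

variable {p : ℕ} [Fact p.Prime] {k : Type u} [Field k] (𝒳 : SchemeOver (WittVector p k))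

/-- `X_m ⟶ X_n` is a closed immersion (base change of `Spec (W_n ↠ W_m)`, `isPullback_thickeningMap`).
[folklore] -/
theorem isClosedImmersion_thickeningMap {m n : ℕ} (h : m ≤ n) :
    IsClosedImmersion (thickeningMap 𝒳 h) :=
  MorphismProperty.of_isPullback (isPullback_thickeningMap 𝒳 h).flip
    (IsClosedImmersion.spec_of_surjective _
      (Ideal.Quotient.factor_surjective (Ideal.pow_le_pow_right h)))

/-- **(F1)** On an affine open `U ⊆ X_n`, `ker (Γ(X_n, U) → Γ(X_m, U ∩ X_m)) ⊆ (p^m)`. [folklore] -/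
theorem ker_app_thickeningMap_le {m n : ℕ} (h : m ≤ n) {U : (thickening 𝒳 n).left.Opens}
    (hU : IsAffineOpen U) :
    RingHom.ker ((thickeningMap 𝒳 h).app U).hom ≤
      Ideal.span {((p ^ m : ℕ) : Γ((thickening 𝒳 n).left, U))} :=
  ker_app_le_span_of_isPullback (Ideal.Quotient.factor_surjective (Ideal.pow_le_pow_right h))
    (p ^ m) (ker_factor_le_span h) (isPullback_thickeningMap 𝒳 h) hU

/-- **(F3)** `p^m = 0` on `X_m`. [folklore] -/
theorem natCast_pow_eq_zero_thickening (m : ℕ) (U : (thickening 𝒳 m).left.Opens) :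
    ((p ^ m : ℕ) : Γ((thickening 𝒳 m).left, U)) = 0 :=
  natCast_eq_zero_of_over (thickening 𝒳 m).hom U _ (natCast_pow_eq_zero_wittQuot m)

variable [CharP k p]

/-- `X_k ⟶ X_{n+1}` is the base change of `Spec k ⟶ Spec W_{n+1}` along `X_{n+1} ⟶ Spec W_{n+1}`
(pullback pasting, `isPullback_pullbackMap_snd`). [folklore] -/
theorem isPullback_specialFibreToThickening (n : ℕ) :
    IsPullback (specialFibreToThickening 𝒳 n) (specialFibre 𝒳).hom (thickening 𝒳 (n + 1)).hom
      (Spec.map (CommRingCat.ofHom (wittQuotToResidue p k n))) :=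
  isPullback_pullbackMap_snd 𝒳.hom _ _ _
    (by rw [← Spec.map_comp, ← CommRingCat.ofHom_comp, wittQuotToResidue_comp_algebraMap])

/-- `X_k ⟶ X_{n+1}` is a closed immersion (base change of `Spec (W_{n+1} ↠ k)`; the `Type`-valued
case is `stub_specialFibreToThickening_closedImmersion`). [folklore] -/
theorem isClosedImmersion_specialFibreToThickening' (n : ℕ) :
    IsClosedImmersion (specialFibreToThickening 𝒳 n) :=
  MorphismProperty.of_isPullback (isPullback_specialFibreToThickening 𝒳 n).flip
    (IsClosedImmersion.spec_of_surjective _ (wittQuotToResidue_surjective p k n))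

/-- **(F2)** On an affine open `V ⊆ X_{n+1}`, `ker (Γ(X_{n+1}, V) → Γ(X_k, V ∩ X_k)) ⊆ (p)`
(`k` perfect). [folklore] -/
theorem ker_app_specialFibreToThickening_le [PerfectRing k p] (n : ℕ)
    {V : (thickening 𝒳 (n + 1)).left.Opens} (hV : IsAffineOpen V) :
    RingHom.ker ((specialFibreToThickening 𝒳 n).app V).hom ≤
      Ideal.span {((p ^ 1 : ℕ) : Γ((thickening 𝒳 (n + 1)).left, V))} :=
  ker_app_le_span_of_isPullback (wittQuotToResidue_surjective p k n) (p ^ 1)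
    (ker_wittQuotToResidue_le_span n) (isPullback_specialFibreToThickening 𝒳 n) hV

/-- **(F3')** `p = 0` on `X_k`. [folklore] -/
theorem natCast_eq_zero_specialFibre (V : (specialFibre 𝒳).left.Opens) :
    ((p ^ 1 : ℕ) : Γ((specialFibre 𝒳).left, V)) = 0 :=
  natCast_eq_zero_of_over (specialFibre 𝒳).hom V _ (by rw [pow_one]; exact CharP.cast_eq_zero k p)

/-- **(F4) Flatness input**: for a smooth proper model `𝒳`, an affine open `U ⊆ X_{n+2}` and
`b ∈ Γ(X_{n+2}, U)` with `p^{n+1} b = 0`, `b ∈ (p)` (`Γ(X_{n+2}, U)` is flat over `W_{n+2}`, where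
`ann(p^{n+1}) = (p)` by `p`-torsion-freeness of `W(k)`, `k` perfect). [folklore] -/
theorem mem_span_p_of_pow_mul_eq_zero_thickening [PerfectRing k p] {d : ℕ}
    (h𝒳 : IsSmoothProperModel d 𝒳) (n : ℕ) {U : (thickening 𝒳 (n + 2)).left.Opens}
    (hU : IsAffineOpen U) (b : Γ((thickening 𝒳 (n + 2)).left, U))
    (hb : ((p ^ (n + 1) : ℕ) : Γ((thickening 𝒳 (n + 2)).left, U)) * b = 0) :
    b ∈ Ideal.span {((p ^ 1 : ℕ) : Γ((thickening 𝒳 (n + 2)).left, U))} := by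
  haveI := h𝒳.smoothOfRelativeDimension
  haveI : Smooth 𝒳.hom := SmoothOfRelativeDimension.smooth d 𝒳.hom
  haveI : Flat (thickening 𝒳 (n + 2)).hom :=
    inferInstanceAs (Flat (pullback.snd 𝒳.hom (Spec.map _)))
  have hf := flat_appLE_comp_ΓSpecIso_inv (thickening 𝒳 (n + 2)).hom hU
  have hxy : ((p ^ (n + 1) : ℕ) : wittQuot p k (n + 2)) * ((p ^ 1 : ℕ) :) = 0 := by
    rw [← Nat.cast_mul, ← pow_add]
    exact natCast_pow_eq_zero_wittQuot (n + 2)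
  have h := mem_span_of_mul_eq_zero_of_flat hf hxy (mem_span_p_of_pow_mul_eq_zero n)
    (a := b) (by rwa [map_natCast])
  rwa [map_natCast] at h

end Tower

/-- **Registered sub-goal** (helper stub of `stub_conormalSheaf_thickeningMap`, `k : Type`): `X_k ⟶ X_{n+1}`
is the base change of `Spec k ⟶ Spec W_{n+1}` along `X_{n+1} ⟶ Spec W_{n+1}`
(`isPullback_specialFibreToThickening`). [folklore] -/
theorem stub_specialFibreToThickening_isPullback :
  ∀ (p : ℕ) [Fact p.Prime] (k : Type) [Field k] [CharP k p]
    (𝒳 : Literature.AlgebraicGeometry.Motives.SchemeOver (WittVector p k)) (n : ℕ),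
    CategoryTheory.IsPullback (Literature.AlgebraicGeometry.Motives.WittScheme.specialFibreToThickening 𝒳 n)
      (Literature.AlgebraicGeometry.Motives.WittScheme.specialFibre 𝒳).hom
      (Literature.AlgebraicGeometry.Motives.WittScheme.thickening 𝒳 (n + 1)).hom
      (AlgebraicGeometry.Spec.map (CommRingCat.ofHom
        (Literature.AlgebraicGeometry.Motives.wittQuotToResidue p k n))) :=
  fun _ _ _ _ _ 𝒳 n => isPullback_specialFibreToThickening 𝒳 n

end Summit.HodgeConjecture.HodgeConjecture.Theorems.PadicPridhamSemiregularity

end
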